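import Literature.Topology.FourManifolds.CappellShanesonClassNumberTwo
import HarnessLib

/-!
# Class-group bookkeeping for the per-trace certificates of Kim–Yamada's Theorem B

Serves the named fact
`Literature.Topology.FourManifolds.kimYamada2023_nonempty_diffeomorph_sphere_four_of_trace_mem_Icc`
(`CappellShaneson.lean`; M. H. Kim, S. Yamada, Kyungpook Math. J. 63 (2023) 373–411 =
arXiv:1707.03860, Cor. C) through the generated per-trace class-group files
`CappellShanesonClassGroup<N>*.lean` (KY §6.1, proof of Thm. B): the small generic lemmas those
files share, hoisted here once (review note on `CappellShanesonClassGroupTwentysix.lean`: "a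
librarian may later hoist them") — classes from two-ideal relations, the non-vanishing of a
certified generator, the non-zero-divisor property of `(p, x)`, membership in `⟨a⟩` / `⟨a⟩ ⊔ ⟨b⟩` from a
class formula, and exponent bookkeeping for two commuting generators (Hermite form `⟨(α, β), (0, γ)⟩`
of a relation lattice). Everything is proved; no named fact (D-0026).

## References

* [KimYamada2023] M. H. Kim, S. Yamada, Kyungpook Math. J. 63 (2023) 373–411 (arXiv:1707.03860),
  §6.1 (proof of Thm. B: the class groups of `ℤ[Θₙ]`).
* [Marcus2018] D. A. Marcus, *Number Fields*, 2nd ed., Ch. 5 (class-group computations after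
  Thm. 37).
-/

noncomputable section

open Ideal
open scoped NumberField nonZeroDivisors

namespace Literature.Topology.FourManifolds

section Dedekind

variable {R : Type*} [CommRing R] [IsDedekindDomain R]

/-- **`[P] = [Q]⁻¹` from `P · Q = (x)`**, `x ≠ 0`, in the class group of a Dedekind domain. [folklore] -/
theorem mk0_eq_inv_of_mul_eq_span {P Q : Ideal R} (hP0 : P ∈ (Ideal R)⁰) (hQ0 : Q ∈ (Ideal R)⁰)
    {x : R} (hx : x ≠ 0) (hPQ : P * Q = span {x}) :
    ClassGroup.mk0 ⟨P, hP0⟩ = (ClassGroup.mk0 ⟨Q, hQ0⟩)⁻¹ :=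
  ClassGroup.mk0_eq_mk0_inv_iff.mpr ⟨x, hx, by simpa using hPQ⟩

/-- **`[P][Q] = [PQ]`** for non-zero ideals of a Dedekind domain. [folklore] -/
theorem mk0_mul_mk0_of_mul_eq {P Q S : Ideal R} (hP0 : P ∈ (Ideal R)⁰) (hQ0 : Q ∈ (Ideal R)⁰)
    (hS0 : S ∈ (Ideal R)⁰) (hPQ : P * Q = S) :
    ClassGroup.mk0 ⟨P, hP0⟩ * ClassGroup.mk0 ⟨Q, hQ0⟩ = ClassGroup.mk0 ⟨S, hS0⟩ := by
  rw [← map_mul]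
  congr 1
  exact Subtype.ext (by simpa using hPQ)

/-- Membership in the cyclic subgroup `⟨a⟩` from a class formula `[P] = Aⁱ`, `A = a` (the proof of
`P ≠ 0` carried by the class may differ from the one at hand). [folklore] -/
theorem mem_zpowers_of_mk0_eq {P : Ideal R} {hP hP' : P ∈ (Ideal R)⁰} {A : ClassGroup R} {i : ℤ}
    (a : ClassGroup R) (h : ClassGroup.mk0 ⟨P, hP'⟩ = A ^ i) (ha : A = a) :
    ClassGroup.mk0 ⟨P, hP⟩ ∈ Subgroup.zpowers a := by
  subst ha
  rw [show ClassGroup.mk0 ⟨P, hP⟩ = ClassGroup.mk0 ⟨P, hP'⟩ from rfl, h]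
  exact Subgroup.zpow_mem_zpowers _ _

/-- Membership in `⟨a⟩ ⊔ ⟨b⟩` from a class formula `[P] = AⁱBʲ`, `A = a`, `B = b`. [folklore] -/
theorem mem_zpowers_sup_of_mk0_eq {P : Ideal R} {hP hP' : P ∈ (Ideal R)⁰} {A B : ClassGroup R}
    {i j : ℤ} (a b : ClassGroup R) (h : ClassGroup.mk0 ⟨P, hP'⟩ = A ^ i * B ^ j) (ha : A = a)
    (hb : B = b) : ClassGroup.mk0 ⟨P, hP⟩ ∈ Subgroup.zpowers a ⊔ Subgroup.zpowers b := by
  subst ha hb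
  rw [show ClassGroup.mk0 ⟨P, hP⟩ = ClassGroup.mk0 ⟨P, hP'⟩ from rfl, h]
  exact Subgroup.mul_mem _ (Subgroup.mem_sup_left (Subgroup.zpow_mem_zpowers _ _))
    (Subgroup.mem_sup_right (Subgroup.zpow_mem_zpowers _ _))

end Dedekind

section Nonvanishing

/-- **`x ≠ 0` from a certificate `x · y = n`** with `n ≠ 0` a natural number, in any ring of
characteristic zero without the need of cancellation. [folklore] -/
theorem ne_zero_of_mul_eq_natCast {R : Type*} [NonAssocSemiring R] [CharZero R] {x : R} (y : R)
    (n : ℕ) (h : x * y = n) (hn : n ≠ 0) : x ≠ 0 := by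
  rintro rfl
  rw [zero_mul] at h
  exact hn (by exact_mod_cast h.symm)

variable {K : Type*} [Field K] [NumberField K]

/-- **`(p, x)` is a non-zero ideal of `𝓞 K`** for a numeral `p ≥ 2` (stated with `OfNat.ofNat p` so
that it matches ideals written with numerals). [folklore] -/
theorem span_pair_ofNat_mem_nonZeroDivisors (p : ℕ) [p.AtLeastTwo] (x : 𝓞 K) :
    span {(OfNat.ofNat p : 𝓞 K), x} ∈ (Ideal (𝓞 K))⁰ := by
  have hp : p ≠ 0 := by have := Nat.AtLeastTwo.prop (n := p); omega
  exact span_pair_natCast_mem_nonZeroDivisors hp x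

end Nonvanishing

/-! ### Exponent bookkeeping for two commuting generators -/

section TwoGenerators

variable {G : Type*} [CommGroup G]

/-- `aⁱbʲ · aᵏbˡ = aⁱ⁺ᵏ bʲ⁺ˡ`. [folklore] -/
theorem cgPair_mul (a b : G) (i j k l : ℤ) :
    a ^ i * b ^ j * (a ^ k * b ^ l) = a ^ (i + k) * b ^ (j + l) := by
  rw [mul_mul_mul_comm, ← zpow_add, ← zpow_add]

/-- `a · aᵏbˡ = a¹⁺ᵏ bˡ`. [folklore] -/
theorem cgPair_amul (a b : G) (k l : ℤ) : a * (a ^ k * b ^ l) = a ^ (1 + k) * b ^ l := by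
  rw [← mul_assoc, ← zpow_one_add]

/-- `b · aᵏbˡ = aᵏ b¹⁺ˡ`. [folklore] -/
theorem cgPair_bmul (a b : G) (k l : ℤ) : b * (a ^ k * b ^ l) = a ^ k * b ^ (1 + l) := by
  rw [mul_left_comm, ← zpow_one_add]

/-- `aⁱbʲ · a = aⁱ⁺¹ bʲ`. [folklore] -/
theorem cgPair_mula (a b : G) (i j : ℤ) : a ^ i * b ^ j * a = a ^ (i + 1) * b ^ j := by
  rw [mul_right_comm, ← zpow_add_one]

/-- `aⁱbʲ · b = aⁱ bʲ⁺¹`. [folklore] -/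
theorem cgPair_mulb (a b : G) (i j : ℤ) : a ^ i * b ^ j * b = a ^ i * b ^ (j + 1) := by
  rw [mul_assoc, ← zpow_add_one]

/-- `a · a = a² b⁰`. [folklore] -/
theorem cgPair_aa (a b : G) : a * a = a ^ (2 : ℤ) * b ^ (0 : ℤ) := by
  rw [zpow_two, zpow_zero, mul_one]

/-- `b · b = a⁰ b²`. [folklore] -/
theorem cgPair_bb (a b : G) : b * b = a ^ (0 : ℤ) * b ^ (2 : ℤ) := by
  rw [zpow_two, zpow_zero, one_mul]

/-- `a · b = a¹ b¹`. [folklore] -/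
theorem cgPair_ab (a b : G) : a * b = a ^ (1 : ℤ) * b ^ (1 : ℤ) := by
  rw [zpow_one, zpow_one]

/-- `b · a = a¹ b¹`. [folklore] -/
theorem cgPair_ba (a b : G) : b * a = a ^ (1 : ℤ) * b ^ (1 : ℤ) := by
  rw [zpow_one, zpow_one, mul_comm]

/-- `(aⁱbʲ)⁻¹ = a⁻ⁱ b⁻ʲ`. [folklore] -/
theorem cgPair_inv (a b : G) (i j : ℤ) : (a ^ i * b ^ j)⁻¹ = a ^ (-i) * b ^ (-j) := by
  rw [mul_inv, ← zpow_neg, ← zpow_neg]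

/-- Integer combination of two relations `a^k₁ b^k₂ = 1`, `a^l₁ b^l₂ = 1`. [folklore] -/
theorem cgPair_comb {a b : G} {k₁ k₂ l₁ l₂ : ℤ} (h1 : a ^ k₁ * b ^ k₂ = 1)
    (h2 : a ^ l₁ * b ^ l₂ = 1) (u v : ℤ) :
    a ^ (k₁ * u + l₁ * v) * b ^ (k₂ * u + l₂ * v) = 1 := by
  rw [zpow_add, zpow_add, zpow_mul, zpow_mul, zpow_mul, zpow_mul, mul_mul_mul_comm, ← mul_zpow,
    ← mul_zpow, h1, h2, one_zpow, one_zpow, one_mul]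

/-- Shifting exponents by the relation lattice `⟨(α, β), (0, γ)⟩`. [folklore] -/
theorem cgPair_shift {a b : G} {α β γ : ℤ} (h1 : a ^ α * b ^ β = 1) (h2 : b ^ γ = 1)
    (r s u v : ℤ) : a ^ r * b ^ s = a ^ (r + α * u) * b ^ (s + β * u + γ * v) := by
  rw [zpow_add, zpow_add, zpow_add, zpow_mul, zpow_mul, zpow_mul, h2, one_zpow, mul_one,
    mul_mul_mul_comm, ← mul_zpow, h1, one_zpow, mul_one]

/-- **Reduction of `aⁱbʲ` to the fundamental domain `0 ≤ r < α`, `0 ≤ s < γ`** of the relation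
lattice generated by `(α, β)` and `(0, γ)`. [folklore] -/
theorem cgPair_enum {a b : G} {α β γ : ℤ} (hα : 0 < α) (hγ : 0 < γ) (h1 : a ^ α * b ^ β = 1)
    (h2 : b ^ γ = 1) (i j : ℤ) :
    ∃ r s : ℤ, 0 ≤ r ∧ r < α ∧ 0 ≤ s ∧ s < γ ∧ a ^ i * b ^ j = a ^ r * b ^ s := by
  refine ⟨i % α, (j - β * (i / α)) % γ, Int.emod_nonneg _ hα.ne', Int.emod_lt_of_pos _ hα,
    Int.emod_nonneg _ hγ.ne', Int.emod_lt_of_pos _ hγ, ?_⟩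
  have hi : α * (i / α) + i % α = i := Int.mul_ediv_add_emod i α
  have hj : γ * ((j - β * (i / α)) / γ) + (j - β * (i / α)) % γ = j - β * (i / α) :=
    Int.mul_ediv_add_emod _ γ
  set q := i / α
  set r := i % α
  set q' := (j - β * q) / γ
  set s := (j - β * q) % γ
  have hj' : j = β * q + (γ * q' + s) := by rw [hj]; ring
  rw [← hi, hj', zpow_add, zpow_mul, zpow_add, zpow_add, zpow_mul, zpow_mul, h2, one_zpow, one_mul,
    mul_mul_mul_comm, ← mul_zpow, h1, one_zpow, one_mul]

end TwoGenerators

end Literature.Topology.FourManifolds
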